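import Literature.AlgebraicGeometry.Resolution.QuadraticTransformsProofs
import HarnessLib

/-!
# Crux `TeissierReduction` (stmt-ResolutionOfSingularities-17085, route `TeissierJung`), line `Sketch`,
# stub `stub_zariskiFiniteValue`: elements of finite value become unit-monomials

Support lemma for the crux
`Summit.ResolutionOfSingularities.ResolutionOfSingularities.Theses.TeissierJung.TeissierReduction`
(stub `stub_zariskiFiniteValue` of the line skeleton; idea card `valuative-koenig-surfaces`): the
VALUATION-THEORETIC ENGINE of Zariski's monomialisation along a valuation (Zariski–Samuel II, App. 5;
Abhyankar 1956), in a form that needs no excellence hypothesis.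

Setting: `R 0` is a two-dimensional regular local ring of the field `K` with fraction field `K`,
dominated by the valuation ring `O`; `R 0 → R 1 → ⋯` is the sequence of quadratic transforms along
`O`; every `R n` carries a prime frame `𝔪ₙ = (xₙ, yₙ)` (`xₙ`, `yₙ` prime elements) and the frames
TRANSPORT (`xₙ`, `yₙ` are units times monomials in `xₙ₊₁, yₙ₊₁`). Claim: a nonzero `F ∈ R 0` of
FINITE value (`ν(w) > ν(F)` for all `w ∈ 𝔪₀ ^ N`, some `N`; multiplicatively `O.valuation w <
O.valuation F`) is a unit times a monomial `xₙᵃ yₙᵇ` at some stage `n`.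

Proof. `x₀ ^ N ∈ 𝔪₀ ^ N`, so `z := x₀ ^ N / F` has value `< 1` and lies in `O`; by Abhyankar's union
lemma (`AbhyankarQuadraticUnion_holds`, PROVED in the tree) `z ∈ R n` for some `n`, i.e.
`F · z = x₀ ^ N` inside the domain `R n`. By transport `x₀ ^ N = U · xₙ ^ A · yₙ ^ B` with `U` a unit
of `R n`, and the primes `xₙ`, `yₙ` peel off the factor `F` one at a time
(`exists_eq_unit_mul_pow_mul_pow_of_mul_eq`, public, any domain).

* `exists_eq_mul_pow_of_mul_eq_mul_pow` — peeling one prime: `F G = W Xᴬ` gives `F = F₁ Xᵃ` with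
  `F₁ G₁ = W` (public; any domain);
* `exists_eq_unit_mul_pow_mul_pow_of_mul_eq` — a divisor of `U Xᴬ Yᴮ` (`U` unit, `X`, `Y` prime) is
  `U' Xᵃ Yᵇ` (public; any domain);
* `stub_zariskiFiniteValue` — the statement above, exactly as registered in the line skeleton.

[folklore]; no definitions, no named facts (the union lemma is a proved tree theorem).
-/

-- single-problem summit: the doubled namespace component is forced
set_option linter.dupNamespace false

noncomputable section

open IsLocalRing Literature.AlgebraicGeometry.Resolution

namespace Summit.ResolutionOfSingularities.ResolutionOfSingularities.Theorems.TeissierReduction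

/-! ## Prime peeling in a domain -/

/-- **Peeling one prime.** In a domain, if `F * G = W * X ^ A` with `X` prime, then all the copies
of `X` distribute over the two factors: `F = F₁ * X ^ a` for some `a` and some `F₁` with
`F₁ * G₁ = W` for a suitable `G₁`. (Induction on `A`: `X ∣ F * G` gives `X ∣ F` or `X ∣ G`; cancel
`X ≠ 0`.) [folklore] -/
theorem exists_eq_mul_pow_of_mul_eq_mul_pow {S : Type*} [CommRing S] [IsDomain S] {X : S}
    (hX : Prime X) : ∀ (A : ℕ) (F G W : S), F * G = W * X ^ A →
      ∃ (a : ℕ) (F₁ G₁ : S), F = F₁ * X ^ a ∧ F₁ * G₁ = W := by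
  intro A
  induction A with
  | zero =>
    intro F G W h
    exact ⟨0, F, G, by rw [pow_zero, mul_one], by rw [h, pow_zero, mul_one]⟩
  | succ A ih =>
    intro F G W h
    have hdvd : X ∣ F * G := ⟨W * X ^ A, by rw [h, pow_succ]; ring⟩
    rcases hX.dvd_or_dvd hdvd with ⟨F', rfl⟩ | ⟨G', rfl⟩
    · -- `X ∣ F`: cancel one `X` and recurse on `F'`
      have h' : F' * G = W * X ^ A := by
        refine mul_left_cancel₀ hX.ne_zero ?_
        linear_combination h
      obtain ⟨a, F₁, G₁, hF₁, hW⟩ := ih F' G W h'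
      exact ⟨a + 1, F₁, G₁, by rw [hF₁, pow_succ]; ring, hW⟩
    · -- `X ∣ G`: cancel one `X` from `G`
      have h' : F * G' = W * X ^ A := by
        refine mul_left_cancel₀ hX.ne_zero ?_
        linear_combination h
      exact ih F G' W h'

/-- **Prime peeling.** In a domain, a divisor of `U * X ^ A * Y ^ B` with `U` a unit and `X`, `Y`
prime elements is itself of this shape: if `F * G = U * X ^ A * Y ^ B` then
`F = U' * X ^ a * Y ^ b` with `U'` a unit. (Peel the `Y`'s, then the `X`'s; what is left of `F`
divides the unit `U`.) [folklore] -/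
theorem exists_eq_unit_mul_pow_mul_pow_of_mul_eq {S : Type*} [CommRing S] [IsDomain S] {X Y : S}
    (hX : Prime X) (hY : Prime Y) : ∀ (A B : ℕ) (F G U : S), IsUnit U →
      F * G = U * X ^ A * Y ^ B → ∃ (a b : ℕ) (U' : S), IsUnit U' ∧ F = U' * X ^ a * Y ^ b := by
  intro A B F G U hU h
  obtain ⟨b, F₁, G₁, hF₁, h₁⟩ := exists_eq_mul_pow_of_mul_eq_mul_pow hY B F G (U * X ^ A) h
  obtain ⟨a, F₂, G₂, hF₂, h₂⟩ := exists_eq_mul_pow_of_mul_eq_mul_pow hX A F₁ G₁ U h₁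
  exact ⟨a, b, F₂, isUnit_of_mul_isUnit_left (h₂ ▸ hU :), by rw [hF₁, hF₂]⟩

/-! ## Transport of unit-monomials along the frames -/

variable {K : Type} [Field K]

/-- Products of unit-monomials in `X, Y ∈ S ⊆ K` are unit-monomials. [folklore] -/
private theorem unitMonomial_mul {S : Subring K} (X Y : S) {t₁ t₂ : K}
    (h₁ : ∃ (a b : ℕ) (u : S), IsUnit u ∧ t₁ = (u : K) * (X : K) ^ a * (Y : K) ^ b)
    (h₂ : ∃ (a b : ℕ) (u : S), IsUnit u ∧ t₂ = (u : K) * (X : K) ^ a * (Y : K) ^ b) :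
    ∃ (a b : ℕ) (u : S), IsUnit u ∧ t₁ * t₂ = (u : K) * (X : K) ^ a * (Y : K) ^ b := by
  obtain ⟨a₁, b₁, u₁, hu₁, rfl⟩ := h₁
  obtain ⟨a₂, b₂, u₂, hu₂, rfl⟩ := h₂
  exact ⟨a₁ + a₂, b₁ + b₂, u₁ * u₂, hu₁.mul hu₂, by push_cast; ring⟩

/-- Powers of unit-monomials in `X, Y ∈ S ⊆ K` are unit-monomials. [folklore] -/
private theorem unitMonomial_pow {S : Subring K} (X Y : S) {t : K} (k : ℕ)
    (h : ∃ (a b : ℕ) (u : S), IsUnit u ∧ t = (u : K) * (X : K) ^ a * (Y : K) ^ b) :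
    ∃ (a b : ℕ) (u : S), IsUnit u ∧ t ^ k = (u : K) * (X : K) ^ a * (Y : K) ^ b := by
  obtain ⟨a, b, u, hu, rfl⟩ := h
  exact ⟨a * k, b * k, u ^ k, hu.pow k, by push_cast; ring⟩

/-- **One step of transport.** If the frame `(xₘ, yₘ)` of `R m ≤ R (m + 1)` consists of
unit-monomials in the frame `(xₘ₊₁, yₘ₊₁)`, then every unit-monomial at stage `m` is a
unit-monomial at stage `m + 1` (units of `R m` stay units in `R (m + 1)`). [folklore] -/
private theorem unitMonomial_succ (R : ℕ → Subring K) (hR : ∀ i, R i ≤ R (i + 1))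
    (x y : (n : ℕ) → R n)
    (htrans : ∀ n,
      (∃ (a b : ℕ) (u : R (n + 1)), IsUnit u ∧
        ((x n : K)) = (u : K) * (x (n + 1) : K) ^ a * (y (n + 1) : K) ^ b) ∧
      (∃ (a b : ℕ) (u : R (n + 1)), IsUnit u ∧
        ((y n : K)) = (u : K) * (x (n + 1) : K) ^ a * (y (n + 1) : K) ^ b))
    (m : ℕ) {t : K}
    (h : ∃ (a b : ℕ) (u : R m), IsUnit u ∧ t = (u : K) * (x m : K) ^ a * (y m : K) ^ b) :
    ∃ (a b : ℕ) (u : R (m + 1)), IsUnit u ∧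
      t = (u : K) * (x (m + 1) : K) ^ a * (y (m + 1) : K) ^ b := by
  obtain ⟨a, b, u, hu, rfl⟩ := h
  have hu' : ∃ (a' b' : ℕ) (u' : R (m + 1)), IsUnit u' ∧
      (u : K) = (u' : K) * (x (m + 1) : K) ^ a' * (y (m + 1) : K) ^ b' :=
    ⟨0, 0, Subring.inclusion (hR m) u, hu.map _, by simp⟩
  exact unitMonomial_mul _ _ (unitMonomial_mul _ _ hu' (unitMonomial_pow _ _ a (htrans m).1))
    (unitMonomial_pow _ _ b (htrans m).2)

/-- **Transport.** Under the same hypotheses, a unit-monomial at stage `m` is a unit-monomial at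
every later stage `k ≥ m`. [folklore] -/
private theorem unitMonomial_of_le (R : ℕ → Subring K) (hR : ∀ i, R i ≤ R (i + 1))
    (x y : (n : ℕ) → R n)
    (htrans : ∀ n,
      (∃ (a b : ℕ) (u : R (n + 1)), IsUnit u ∧
        ((x n : K)) = (u : K) * (x (n + 1) : K) ^ a * (y (n + 1) : K) ^ b) ∧
      (∃ (a b : ℕ) (u : R (n + 1)), IsUnit u ∧
        ((y n : K)) = (u : K) * (x (n + 1) : K) ^ a * (y (n + 1) : K) ^ b))
    {m k : ℕ} (hmk : m ≤ k) {t : K}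
    (h : ∃ (a b : ℕ) (u : R m), IsUnit u ∧ t = (u : K) * (x m : K) ^ a * (y m : K) ^ b) :
    ∃ (a b : ℕ) (u : R k), IsUnit u ∧ t = (u : K) * (x k : K) ^ a * (y k : K) ^ b := by
  induction hmk with
  | refl => exact h
  | step _ ih => exact unitMonomial_succ R hR x y htrans _ ih

/-! ## The stub -/

/-- **Zariski's finite-value monomialisation** (STUB `stub_zariskiFiniteValue` of line `Sketch`, card
`valuative-koenig-surfaces`; the valuation-theoretic engine, NO excellence needed). Along the sequence
`R₀ → R₁ → ⋯` of quadratic transforms of a two-dimensional regular local ring `R₀` of `K` along a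
valuation ring `O` dominating it, equipped with prime frames `𝔪ₙ = (xₙ, yₙ)` in which `xₙ, yₙ` are
unit-monomials in `xₙ₊₁, yₙ₊₁`, every nonzero `F ∈ R₀` of FINITE value (`ν(w) > ν(F)` for all
`w ∈ 𝔪₀ ^ N`, some `N`) is a unit times a monomial `xₙᵃ yₙᵇ` at some stage `n`. Proof: `x₀ ^ N / F`
lies in `O`, hence (Abhyankar's union lemma `AbhyankarQuadraticUnion_holds`) in some `R n`, so
`F ∣ x₀ ^ N` in `R n`; `x₀ ^ N` is a unit-monomial at stage `n` by transport, and the primes `xₙ, yₙ`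
peel off `F`. [Zariski–Samuel II App. 5; Abhyankar 1956, Lemma 12] -/
theorem stub_zariskiFiniteValue {K : Type} [Field K] (O : ValuationSubring K) (R : ℕ → Subring K)
    [IsRegularLocalRing (R 0)] (hdim : ringKrullDim (R 0) = 2) (hof : IsLocalRingOf (R 0))
    (hdom : SubringDominates (R 0) O.toSubring)
    (hstep : ∀ i, IsQuadraticTransformAlong O (R i) (R (i + 1)))
    (hloc : ∀ n, IsLocalRing (R n)) (x y : (n : ℕ) → R n)
    (hframe : ∀ n, @IsLocalRing.maximalIdeal (R n) _ (hloc n) = Ideal.span {x n, y n})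
    (hprime : ∀ n, Prime (x n) ∧ Prime (y n))
    (htrans : ∀ n,
      (∃ (a b : ℕ) (u : R (n + 1)), IsUnit u ∧
        ((x n : K)) = (u : K) * (x (n + 1) : K) ^ a * (y (n + 1) : K) ^ b) ∧
      (∃ (a b : ℕ) (u : R (n + 1)), IsUnit u ∧
        ((y n : K)) = (u : K) * (x (n + 1) : K) ^ a * (y (n + 1) : K) ^ b))
    (F : R 0) (hF : F ≠ 0)
    (hfin : ∃ N : ℕ, ∀ w ∈ (@IsLocalRing.maximalIdeal (R 0) _ (hloc 0)) ^ N,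
      O.valuation ((w : R 0) : K) < O.valuation ((F : R 0) : K)) :
    ∃ (n a b : ℕ) (u : R n), IsUnit u ∧
      ((F : K)) = (u : K) * (x n : K) ^ a * (y n : K) ^ b := by
  obtain ⟨N, hN⟩ := hfin
  -- (1) `x₀ ^ N ∈ 𝔪₀ ^ N` has value below that of `F`, so `z := x₀ ^ N / F ∈ O`
  have hx0 : x 0 ∈ @IsLocalRing.maximalIdeal (R 0) _ (hloc 0) := by
    rw [hframe 0]
    exact Ideal.subset_span (Set.mem_insert _ _)
  have hxN := hN _ (Ideal.pow_mem_pow hx0 N)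
  rw [Subring.coe_pow] at hxN
  have hF0 : ((F : R 0) : K) ≠ 0 := fun e => hF (Subtype.ext e)
  have hvF0 : 0 < O.valuation ((F : R 0) : K) :=
    pos_iff_ne_zero.mpr ((_root_.map_ne_zero _).mpr hF0)
  have hzO : ((x 0 : R 0) : K) ^ N / ((F : R 0) : K) ∈ O := by
    rw [← O.valuation_le_one_iff, map_div₀, div_le_one₀ hvF0]
    exact le_of_lt hxN
  -- (2) Abhyankar's union lemma: `z ∈ R n` for some `n`
  obtain ⟨n, hzn⟩ :=
    (AbhyankarQuadraticUnion_holds K O R ‹_› hdim hof hdom hstep _).mp hzO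
  -- (3) transport `x₀ ^ N` to a unit-monomial at stage `n`
  obtain ⟨A, B, U, hU, hAB⟩ : ∃ (A B : ℕ) (U : R n), IsUnit U ∧
      ((x 0 : R 0) : K) ^ N = (U : K) * (x n : K) ^ A * (y n : K) ^ B :=
    unitMonomial_of_le R (fun i => (hstep i).le) x y htrans (Nat.zero_le n)
      ⟨N, 0, 1, isUnit_one, by simp⟩
  -- (4) the equation `F · z = U · xₙ ^ A · yₙ ^ B` inside the domain `R n`
  have hRle : R 0 ≤ R n := sequence_monotone hstep (Nat.zero_le n)
  have heq : (⟨((F : R 0) : K), hRle F.2⟩ : R n) * ⟨_, hzn⟩ = U * x n ^ A * y n ^ B := by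
    apply Subtype.ext
    change ((F : R 0) : K) * (((x 0 : R 0) : K) ^ N / ((F : R 0) : K)) =
      (((U * x n ^ A * y n ^ B : R n)) : K)
    push_cast
    rw [← hAB, mul_div_cancel₀ _ hF0]
  -- (5) peel the primes `xₙ`, `yₙ` off `F`
  obtain ⟨a, b, U', hU', hFab⟩ :=
    exists_eq_unit_mul_pow_mul_pow_of_mul_eq (hprime n).1 (hprime n).2 A B _ _ U hU heq
  refine ⟨n, a, b, U', hU', ?_⟩
  have hK := congrArg (fun t : R n => (t : K)) hFab
  push_cast at hK
  exact hK

end Summit.ResolutionOfSingularities.ResolutionOfSingularities.Theorems.TeissierReduction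

end
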